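import Mathlib
import Literature.MathematicalPhysics.QuantumFieldTheory.Balaban1983to89.B13Sect1Arith
import Literature.MathematicalPhysics.QuantumFieldTheory.Balaban1983to89.B13Eq117Hk
import Literature.MathematicalPhysics.QuantumFieldTheory.Balaban1983to89.B9

/-!
# `Balaban1983to89.B13Sect1Statements` — T. Bałaban, *Renormalization group approach to lattice gauge field theories.
II. Cluster expansions*, Commun. Math. Phys. **116** (1988) 1–22 [Balaban1988RG2Cluster]: Sect. 1 display statements
(1.27), (1.28) p. 8 and the common-domain-of-analyticity sentence p. 7 as named `Prop`s (X-read targets requested by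
the NE spine), with the proofs the tree already has wired to them

statement-level skeleton of published theorems with citation tags; proofs where landed; nothing here is a claim about
the Yang–Mills mass gap

PDF held: `paper:balaban1988-cmp116-rg-ii-cluster` (journal page = PDF page + 0); quotations read as images from
`run/shared/lean/pub/pub-balaban/b2b-balaban-ref1/pages/1988-cmp116-rg-II-cluster/1988-cmp116-rg-II-cluster-p007-x2.png`
and `…-p008-x2.png`.

CITATION HEADER / WHAT IS REPRODUCED (unit `lit-balaban-r10`; SKELETON rows `B13.Eq1.27-1.28` (= `B13.Eq1.27`,
`B13.Eq1.28` of `HOME/lit-balaban-r10/ROWS-B13.md`) and `B13.Txt@7`; requested in `HOME/INBOX.md` 2026-08-20T22:21Z /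
22:25Z by the T4-DAG writer — NEED-2 «[II] (1.27)–(1.28) p.8 level-count displays as Printed Props» and NEED «[II]
p. 7, the sentences after (1.24)–(1.25) … A `B13Sect1Statements`-style display decl (hypothesis-shape, the analyticity
as a Prop over an abstract configuration-space carrier)»):
* `Eq127` — (1.27) AS PRINTED, the «for κ₁ sufficiently large» as the ∃ of a threshold; PROVED (`Eq127_holds`) from
  the sibling certificate `B13Sect1Arith.bound_127` (threshold κ₁ ≥ 1 + 2 log(8·12³); the numeral 8·12³ = the number
  of cubes Δ ⊂ □₀∖□̃⁴ is the paper's and is carried as the printed hypothesis on the family, not verified).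
* `Eq128` — (1.28) AS PRINTED over the abstract system of localization domains 𝐃_k (`Setup.LocDomainSys`, tree length
  `dj` = d_k) and the cube count `vol Y` = M⁻⁴|Y|.  Its first inequality is the lower half of (2.30) p. 18, which is
  FALSE for degenerate domains (d_k(Y) = 0 with |Y| ≥ 1: `TreeLength.treeLen_singleton`; cell GAPS G-B13-07) — the Prop
  is typed for the record and for X-reads; what the tree PROVES is the conditional form `eq128_of_lower230` (from
  `B13Sect1Arith.bound_128_printed`: given the volume bound M⁻⁴|Y| ≤ 24·d_k(Y), d_k(Y) ≥ 1 and κ₁ ≥ 2 + 16 log 24) and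
  the repaired affine form `B13Sect1Arith.bound_128_repaired` / `TreeLength.card_le_treeLen`.
* `CommonDomain7` — p. 7: *"All terms (1.23) with the localization domain Y are defined and analytic on this space
  [U^c_{k+1}(Y, (1+β)α₀, (1+β)α₁, α₀)]"* over ABSTRACT carriers: configurations `Φ` (= (𝐔, 𝐉)), the spaces
  `Uc X a₀ a₁ a₂` (= U^c_{k+1}(X, a₀, a₁, a₂) of [I] (3.16): the conditions I.(i)–(iii) on the domain X with the three
  constants; reader-owned, as `B13.StepData.sp1/sp2`), an analyticity predicate `Analytic f s` (reader-owned, as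
  `B13.StepData.Analytic`), the terms (1.23) `T i` indexed by `i` = (□₀, Y₀, j, X) with localization domain
  `loc i` = Y = Y₀ ∪ □₀.  The premise sentence (*"From the results of Sect. I.3 … defined on the space
  U^c_{k+1}(□₀, (1+2β)α₀, (1+2β)α₁, α₀) … depends on 𝐔, 𝐉 restricted to Y … we consider this space defined by the
  conditions I.(i)–(iii) on the domain Y"*) is `OnDomain7`, and the printed passage premise ⇒ conclusion is the PROVED
  bookkeeping `commonDomain7_of_onDomain` (restriction of an analytic function to the smaller space with the smaller
  constants (1+β)α ≤ (1+2β)α).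
Nothing of the series is asserted; no decl for the located ABSENCES the consumers flagged (coupling-history modulus,
two-spacing rate).  HOME: `run/shared/lean/pub/lit-balaban/` (ROWS-B13.md, INTERFACES.md §1 rows NE5/NE9).

v2 (unit `lit-balaban-r10` gen 2, 2026-08-21; APPEND-ONLY; SKELETON row `B13.Eq1.19`, absent at v3.8 and ranked by the
lead's `ABSENT-RANKED.md` (219 dependants); render `…-p006-x2.png` re-read as an image):
* `Bprime119` — **(1.19) p. 6**, verbatim *"We have to consider the function B′ yet. Notice that in the preceding
  considerations B′ was a variable field. The function is given by the formula* `B′ = g_kCB − hD̃(g_kCB).` (1.19)"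
  (= [Balaban1987RG1] (3.2) p. 270, SKELETON row B12.Eq3.2) — the map `B ↦ B′` as a named object over abstract normed
  spaces: `g_k` a scalar, `C` a linear operator (the background-field operator `C` of [I] (2.10)), `h` the linear
  operator and `D̃` the function of the linearizing change of variables of [I] p. 267 (tree: `B12Lineariz267`, whose
  substitution `Φ Y = Y − hop (Dt Y)` this is at `Y = g_kCB`: `Bprime119_eq_phi`; the sibling `B13PkScaling` reads
  (1.19) the same way, *"`Ψ₁(g_kB)`"*).
* `norm_Bprime119_le`, `norm_Bprime119_le_C₁` — **(1.20) p. 6**, *"It satisfies the bound |B′| ≦ O(1)g_k|B| +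
  4C₂(O(1)g_k|B|)² ≦ C₁g_k|B| < C₁ε₁, (1.20) where C₁ is an absolute constant, and g_k|B| < ε₁."* — the FIRST
  inequality PROVED from the two inputs the print uses (`‖CB‖ ≤ O(1)‖B‖` and the quadratic bound `‖hD̃(Y)‖ ≤ 4C₂‖Y‖²`
  of [I] p. 267 / `B12Lineariz267.norm_hop_Dt_le` — taken as hypotheses on the abstract data), the second is the
  sibling's `B13Sect1Arith.bound_120` (explicit `C₁ = c₀(1 + 4C₂c₀ε₁)`), assembled.  No named fact (D-0026).

v3 (unit `lit-balaban-r10` gen 3, 2026-08-21; APPEND-ONLY; SKELETON rows `B13.Eq1.1`, `B13.Eq1.6`, `B13.Eq1.7` — the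
three Sect. 1 rows still `absent` at SKELETON v3.19, ranked 2nd/1st/3rd of the ABSENT free-target board of DEPGRAPH v8
§2e.2 (368/369/362 transitive dependants) and, for (1.6)–(1.7), NE-cited (INTERFACES.md §1.3 locus `B13.Eq1.5-1.8`,
F-T4-206, labels NE3/NE5/NE9); renders `…-p002-x2.png`, `…-p003-x2.png` re-read as images this generation):
* `A11` — **(1.1) p. 2**, verbatim *"For example let us consider the last term on the right-hand side of (I.3.34). We
  have proved that it is an analytic function of 𝐔, 𝐉, 𝐀, for (𝐔, 𝐉) ∈ U^c_{k+1}(□₀, (1+2β)α₀, (1+2β)α₁, α₀) and 𝐀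
  satisfying (I.3.31). Substituting* `𝐀 = (tζ̃_□ + t_□ζ_□)𝐇_k(B′)` (1.1) *we introduce, through the function 𝐇_k(B′), a
  dependence on 𝐔, 𝐉, B on the whole lattice."* — the substituted nonlocal argument as a named object on the abstract
  complex-normed-space model of the siblings `B13Eq117Hk` (seat p32: `Hk` = the function 𝐇_k(B′) of (1.2)/(1.17)) and
  `B13Sect1Arith`: `ζ̃_□`, `ζ_□` = bounded linear operators (multiplication by the cut-off functions of (I.3.34)),
  `t`, `t_□` = the interpolation parameters of (I.3.34) (scalars).  PROVED for the typed object: its norm bound through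
  (1.18) (`norm_A11_Hk_le`) and *"an analytic function of … B"* through `B13Eq117Hk.analyticOnNhd_Hk`
  (`analyticOnNhd_A11_Hk`).
* `Eq16`, `Ineq17`, `Eq16_17` — **(1.6)–(1.7) p. 3**, verbatim *"A propagator is represented by the sum (3.107) [13]*
  `Σ_ω R₀(X₀)R_{α₁}(X₁)⋯R_{αₙ}(Xₙ),` (1.6) *where ω = ((0, X₀)(α₁, X₁), …, (αₙ, Xₙ)), X₀, X₁, …, Xₙ are simple
  localization domains, unions of connected families containing several cubes from π_k(1), i.e. of the size M₁ instead
  of M. For more detailed explanations of (1.6) see Sect. C [13]. Localization properties and bounds are important for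
  us. Each factor in (6.6) [sic: (1.6)] depends on external gauge field configurations restricted to the corresponding
  domain X̃ⱼ⁵, and its kernel vanishes in a sufficiently thick neighborhood of ∂Xⱼ, e.g. in a neighborhood of the width
  ⅓M₁. The term corresponding to a walk ω in (1.6) can be bounded, as (3.108) [13], by*
  `O(1)O(M₁^{−1/2})^{|ω|}M₁^{−1/2|ω|}exp(−δ₀d(ω, y, y′)),` (1.7) *where Δ(y), Δ(y′) are localization cubes of the term.
  This bound holds for all operator norms in formulations of theorems in [13], e.g. in Theorem 3.1. The first two
  factors in (1.7) are used to control the sum over ω, and they determine the constant B₀."* — typed BY NAME over the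
  carriers of the by-reference source [13] = [Balaban1985BackgroundPropagators] as they stand in the tree (`B9.Geometry`,
  `B9.Backgrounds`, `B9.RWExpansion` = the walks ω with |ω|, d(ω, y, y′), the walk terms and their locality predicate;
  `B9.walkFactor` = the printed factor of (3.94)/(3.108)): (1.6) = the operator IS represented by the convergent
  expansion (`RWExpansion.Converges`), (1.7) = locality of the walk term + the bound with the factor
  `B9.walkFactor C c M₁ (2δ₀) |ω| d(ω,y,y′)` — which IS the printed `O(1)O(M₁^{−1/2})^{|ω|}M₁^{−1/2|ω|}e^{−δ₀d(ω,y,y′)}`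
  (`walkFactor_17`: [13] prints `e^{−½δ₀d}`, this paper `e^{−δ₀d}`, so B13's δ₀ is half of B9's) — times the norm
  prefactor `A y` (*"all operator norms in formulations of theorems in [13]"*: (Lʲη)² for the sup-norm of (3.42), …) and
  |J|.  PROVED: `eq16_17_of_thm310` — [13] Theorem 3.10 AS TYPED in the tree (`B9.Thm310Printed`, SKELETON row
  `B9.Thm3.10`) delivers (1.6) ∧ (1.7) for every member of the family it quantifies over, with `A y = (Lʲη)²` and B13's
  δ₀ = ½·(B9's δ₀) — the DEPGRAPH edge `B13.Eq1.6/1.7 → B9.Thm3.10` as a Lean implication; `sumControl_17` — the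
  sentence *"The first two factors in (1.7) are used to control the sum over ω, and they determine the constant B₀"* as
  the kernel arithmetic `B9.walkSum_le` BY NAME: with ≤ Nⁿ walks of length n and `2Nc ≤ M₁^{1/2}`, the partial sums of
  (number of walks) × (first two factors) are ≤ 2·O(1) =: B₀.  Nothing of the series is constructed (no instance of
  `RWExpansion` exists in the tree; [13] Sect. C is itself a by-reference sketch, GAPS G-B9-07); no named fact (D-0026).
-/

noncomputable section

namespace Literature.MathematicalPhysics.QuantumFieldTheory.Balaban1983to89.B13Sect1Statements

open Literature.MathematicalPhysics.QuantumFieldTheory.Balaban1983to89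

/-! ## (1.27) p. 8 -/

/-- **(1.27)** p. 8 [PDF 8], verbatim: *"The sum over Y₀ is simply a sum over subsets of the family of cubes Δ
contained in □₀∖□̃⁴. The number of terms in this sum is an absolute number, but we get a better bound using the last
term under the exponential in (1.25). The sum is bounded by* `exp(8·12³ exp(−½(κ₁ − 1))) ≦ e` (1.27) *for κ₁
sufficiently large."* — typed reading: there is a threshold K such that for every κ₁ ≥ K and every finite family F
of at most 8·12³ cubes (the paper's count of the cubes of □₀∖□̃⁴, carried as printed), the sum over the subsets W ⊆ F
of the factors e^{−½(κ₁−1)|W|} left by (1.25) is ≤ exp(8·12³e^{−½(κ₁−1)}) ≤ e. [cite: Balaban1988RG2Cluster, (1.27) p.8] -/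
def Eq127 : Prop :=
  ∃ K : ℝ, ∀ κ₁ : ℝ, K ≤ κ₁ → ∀ {α : Type} [DecidableEq α] (F : Finset α), (F.card : ℝ) ≤ 8 * 12 ^ 3 →
    ∑ W ∈ F.powerset, Real.exp (-(1 / 2) * (κ₁ - 1)) ^ W.card
        ≤ Real.exp (8 * 12 ^ 3 * Real.exp (-(1 / 2) * (κ₁ - 1))) ∧
      Real.exp (8 * 12 ^ 3 * Real.exp (-(1 / 2) * (κ₁ - 1))) ≤ Real.exp 1

/-- (1.27) holds, with the explicit threshold κ₁ ≥ 1 + 2 log(8·12³) ≈ 20.07 of `B13Sect1Arith.threshold_127` /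
`bound_127`. [cite: Balaban1988RG2Cluster, (1.27) p.8] -/
theorem Eq127_holds : Eq127 :=
  ⟨1 + 2 * Real.log (8 * 12 ^ 3), fun _ hκ _ _ F hF => B13Sect1Arith.bound_127 F hF hκ⟩

/-! ## (1.28) p. 8 -/

/-- **(1.28)** p. 8 [PDF 8], verbatim: *"Finally, the sum over □₀ can be bounded by*
`M⁻⁴|Y| ≦ 3·2³ d_k(Y) ≦ exp (1/16)(κ₁ − 2) d_k(Y).` (1.28)" — typed AS PRINTED over the system `D` of localization
domains 𝐃_k with tree length `D.dj` = d_k ([I] p. 257) and the cube count `vol Y` = M⁻⁴|Y| (number of π_k-cubes of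
Y): both inequalities for every Y.  RECORD ONLY: the first inequality is the lower half of (2.30) p. 18 and fails for
degenerate domains (d_k(Y) = 0, |Y| ≥ 1 — cell GAPS G-B13-07; `TreeLength.treeLen_singleton`); the tree's proved
forms are `eq128_of_lower230` below (conditional, as the paper uses it: p. 8 *"we sum over X with d_j(X) ≠ 0, as it
follows from our inductive construction"*) and the repaired `B13Sect1Arith.bound_128_repaired`.
[cite: Balaban1988RG2Cluster, (1.28) p.8] -/
def Eq128 (D : LocDomainSys) (vol : D.Dom → ℕ) (κ₁ : ℝ) : Prop :=
  ∀ Y : D.Dom, (vol Y : ℝ) ≤ 3 * 2 ^ 3 * D.dj Y ∧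
    3 * 2 ^ 3 * D.dj Y ≤ Real.exp ((1 / 16) * (κ₁ - 2) * D.dj Y)

/-- (1.28) in the regime where the paper uses it: if every domain has d_k(Y) ≥ 1 and satisfies the volume bound
M⁻⁴|Y| ≤ 3·2³d_k(Y) (the lower half of (2.30), an INPUT here), then for κ₁ ≥ 2 + 16 log 24 both printed inequalities
hold (`B13Sect1Arith.bound_128_printed`). [cite: Balaban1988RG2Cluster, (1.28) p.8] -/
theorem eq128_of_lower230 (D : LocDomainSys) (vol : D.Dom → ℕ) {κ₁ : ℝ}
    (hvol : ∀ Y, (vol Y : ℝ) ≤ 24 * D.dj Y) (hd : ∀ Y, 1 ≤ D.dj Y) (hκ : 2 + 16 * Real.log 24 ≤ κ₁) :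
    Eq128 D vol κ₁ := by
  intro Y
  have h := B13Sect1Arith.bound_128_printed (hvol Y) (hd Y) hκ
  refine ⟨?_, ?_⟩
  · have : (3 : ℝ) * 2 ^ 3 = 24 := by norm_num
    rw [this]; exact hvol Y
  · have : (3 : ℝ) * 2 ^ 3 * D.dj Y = 24 * D.dj Y := by norm_num
    rw [this]; exact h.1

/-! ## p. 7: the common domain of analyticity of the terms (1.23) -/

section CommonDomain

variable {ι Φ : Type} (D : LocDomainSys) (Uc : D.Dom → ℝ → ℝ → ℝ → Set Φ)
  (Analytic : (Φ → ℂ) → Set Φ → Prop) (T : ι → Φ → ℂ) (loc : ι → D.Dom) (α₀ α₁ β : ℝ)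

/-- p. 7 [PDF 7], the PREMISE sentences, verbatim: *"Before considering such a sum we have to take a common domain of
analyticity for all terms in it. From the results of Sect. I.3 it follows that the term (1.23) is an analytic function
of configurations 𝐔, 𝐉, defined on the space U^c_{k+1}(□₀, (1+2β)α₀, (1+2β)α₁, α₀). By the construction it depends
on 𝐔, 𝐉 restricted to Y₀ ∪ □₀ = Y, and the conditions outside Y are unessential. Thus we consider this space defined
by the conditions I.(i)–(iii) on the domain Y"* — typed reading (the locality step taken): every term (1.23), index
`i` = (□₀, Y₀, j, X) with localization domain `loc i` = Y, is analytic on `Uc (loc i) ((1+2β)α₀) ((1+2β)α₁) α₀` =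
U^c_{k+1}(Y, (1+2β)α₀, (1+2β)α₁, α₀) (the space of [I] (3.16): conditions I.(i)–(iii) on the domain with the three
constants; `Uc`, `Analytic` reader-owned as in `B13.StepData`). [cite: Balaban1988RG2Cluster, p.7 (after (1.25))] -/
def OnDomain7 : Prop :=
  ∀ i : ι, Analytic (T i) (Uc (loc i) ((1 + 2 * β) * α₀) ((1 + 2 * β) * α₁) α₀)

/-- p. 7 [PDF 7], the CONCLUSION, verbatim: *"… and we take its subspace U^c_{k+1}(Y, (1+β)α₀, (1+β)α₁, α₀). All
terms (1.23) with the localization domain Y are defined and analytic on this space."* — the common, k-independent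
enlargement of the small-field space on which the history terms are analytic functions of the free complex
configurations (the statement the NE spine's NE5/NE9 rows consume BY NAME). [cite: Balaban1988RG2Cluster, p.7 (after (1.25))] -/
def CommonDomain7 : Prop :=
  ∀ i : ι, Analytic (T i) (Uc (loc i) ((1 + β) * α₀) ((1 + β) * α₁) α₀)

/-- The printed passage premise ⇒ conclusion, p. 7 *"we take its subspace"*: with restriction of analytic functions
to subsets (`hres`) and the spaces U^c_{k+1}(Y, a₀, a₁, a₂) growing with the constants a₀, a₁ (`hmono`; larger
constants = weaker conditions I.(i)–(ii)), and 0 ≤ β, 0 ≤ α₀, 0 ≤ α₁, the terms analytic on the (1+2β)-spaces are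
analytic on the common (1+β)-subspace. [cite: Balaban1988RG2Cluster, p.7 (after (1.25))] -/
theorem commonDomain7_of_onDomain
    (hres : ∀ (f : Φ → ℂ) (s t : Set Φ), s ⊆ t → Analytic f t → Analytic f s)
    (hmono : ∀ (X : D.Dom) (a₀ a₀' a₁ a₁' a₂ : ℝ), a₀ ≤ a₀' → a₁ ≤ a₁' → Uc X a₀ a₁ a₂ ⊆ Uc X a₀' a₁' a₂)
    (hβ : 0 ≤ β) (hα₀ : 0 ≤ α₀) (hα₁ : 0 ≤ α₁)
    (h : OnDomain7 D Uc Analytic T loc α₀ α₁ β) : CommonDomain7 D Uc Analytic T loc α₀ α₁ β := by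
  intro i
  refine hres _ _ _ (hmono (loc i) _ _ _ _ α₀ ?_ ?_) (h i)
  · exact mul_le_mul_of_nonneg_right (by linarith) hα₀
  · exact mul_le_mul_of_nonneg_right (by linarith) hα₁

end CommonDomain

/-! ## (1.19)–(1.20) p. 6 (v2, append-only): the map `B ↦ B′ = g_kCB − hD̃(g_kCB)` and its linear-order bound -/

section Eq119

variable {𝕜 : Type*} [NormedField 𝕜] {𝒵 𝒴 𝒳 : Type*}
  [NormedAddCommGroup 𝒵] [NormedSpace 𝕜 𝒵] [NormedAddCommGroup 𝒴] [NormedSpace 𝕜 𝒴]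
  [AddCommGroup 𝒳] [Module 𝕜 𝒳]

/-- **(1.19)** p. 6 [PDF 6], verbatim: *"We have to consider the function B′ yet. Notice that in the preceding
considerations B′ was a variable field. The function is given by the formula* `B′ = g_kCB − hD̃(g_kCB).` (1.19)"
(the formula (I.3.2) of [Balaban1987RG1] p. 270).  Typed over abstract normed spaces: `B ∈ 𝒵` (the fluctuation
field), `Cop : 𝒵 →ₗ 𝒴` (the linear background-field operator `C` of [I] (2.10)), `hop : 𝒳 →ₗ 𝒴` and `Dt : 𝒴 → 𝒳`
(the operator `h` and the function `D̃` of the linearizing change of variables of [I] p. 267 — the data of the tree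
module `B12Lineariz267`, whose substitution `Y ↦ Y − hop (Dt Y)` this is at `Y = g_kCB`, `Bprime119_eq_phi`; the
sibling `B13PkScaling` reads (1.19) as `Ψ₁(g_kB)` with the same `Ψ₁`), `g = g_k` a scalar.
[cite: Balaban1988RG2Cluster, (1.19) p.6] -/
def Bprime119 (g : 𝕜) (Cop : 𝒵 →ₗ[𝕜] 𝒴) (hop : 𝒳 →ₗ[𝕜] 𝒴) (Dt : 𝒴 → 𝒳) (B : 𝒵) : 𝒴 :=
  g • Cop B - hop (Dt (g • Cop B))

/-- (1.19) IS the linearizing substitution `Φ Y = Y − hD̃(Y)` of [I] p. 267 (`B12Lineariz267`, rows B12.Def@267 /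
B12.Eq3.2) evaluated at `Y = C(g_kB) = g_kCB`. [cite: Balaban1988RG2Cluster, (1.19) p.6] -/
theorem Bprime119_eq_phi (g : 𝕜) (Cop : 𝒵 →ₗ[𝕜] 𝒴) (hop : 𝒳 →ₗ[𝕜] 𝒴) (Dt : 𝒴 → 𝒳)
    (B : 𝒵) : Bprime119 g Cop hop Dt B = (fun Y : 𝒴 => Y - hop (Dt Y)) (Cop (g • B)) := by
  simp only [Bprime119, map_smul]

/-- **(1.20) p. 6, first inequality** — *"It satisfies the bound |B′| ≦ O(1)g_k|B| + 4C₂(O(1)g_k|B|)²"* — from the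
two inputs the print uses: the bound `‖CB‖ ≤ c₀‖B‖` of the operator `C` (`c₀` = the printed `O(1)`) and the quadratic
bound `‖hD̃(Y)‖ ≤ 4C₂‖Y‖²` on `‖Y‖ < ε` of [I] p. 267 (*"D̃(B) has an expansion beginning with quadratic terms"*;
tree: `B12Lineariz267.norm_hop_Dt_le`, with the operator norm of `h` absorbed into `C₂`), both HYPOTHESES on the
abstract data; valid as long as `c₀·|g_k|·‖B‖ < ε`. [cite: Balaban1988RG2Cluster, (1.20) p.6] -/
theorem norm_Bprime119_le {c₀ C₂ ε : ℝ} {Cop : 𝒵 →ₗ[𝕜] 𝒴} {hop : 𝒳 →ₗ[𝕜] 𝒴} {Dt : 𝒴 → 𝒳}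
    (hC : ∀ B, ‖Cop B‖ ≤ c₀ * ‖B‖) (hC₂ : 0 ≤ C₂)
    (hD : ∀ Y : 𝒴, ‖Y‖ < ε → ‖hop (Dt Y)‖ ≤ 4 * C₂ * ‖Y‖ ^ 2) {g : 𝕜} {B : 𝒵}
    (hε : c₀ * (‖g‖ * ‖B‖) < ε) :
    ‖Bprime119 g Cop hop Dt B‖ ≤ c₀ * (‖g‖ * ‖B‖) + 4 * C₂ * (c₀ * (‖g‖ * ‖B‖)) ^ 2 := by
  set x : ℝ := c₀ * (‖g‖ * ‖B‖) with hx
  have hY : ‖g • Cop B‖ ≤ x := by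
    rw [norm_smul, hx, mul_left_comm]
    exact mul_le_mul_of_nonneg_left (hC B) (norm_nonneg _)
  have hY0 : 0 ≤ ‖g • Cop B‖ := norm_nonneg _
  have hYε : ‖g • Cop B‖ < ε := lt_of_le_of_lt hY hε
  calc ‖Bprime119 g Cop hop Dt B‖
      ≤ ‖g • Cop B‖ + ‖hop (Dt (g • Cop B))‖ := norm_sub_le _ _
    _ ≤ ‖g • Cop B‖ + 4 * C₂ * ‖g • Cop B‖ ^ 2 := by
        have := hD _ hYε; linarith
    _ ≤ x + 4 * C₂ * x ^ 2 := by
        have h2 : ‖g • Cop B‖ ^ 2 ≤ x ^ 2 := pow_le_pow_left₀ hY0 hY 2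
        have := mul_le_mul_of_nonneg_left h2 (by positivity : (0 : ℝ) ≤ 4 * C₂)
        linarith

/-- **(1.20) p. 6, assembled**: *"|B′| ≦ O(1)g_k|B| + 4C₂(O(1)g_k|B|)² ≦ C₁g_k|B| < C₁ε₁, (1.20) where C₁ is an
absolute constant, and g_k|B| < ε₁"* — with the explicit `C₁ = c₀(1 + 4C₂c₀ε₁)` of the sibling certificate
`B13Sect1Arith.bound_120` (its "absolute" size `≤ 2c₀` under `4C₂c₀ε₁ ≤ 1` is `B13Sect1Arith.C₁_le_120`), for
`|g_k|·‖B‖ < ε₁` inside the domain `c₀ε₁ ≤ ε` of the quadratic bound. [cite: Balaban1988RG2Cluster, (1.20) p.6] -/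
theorem norm_Bprime119_le_C₁ {c₀ C₂ ε ε₁ : ℝ} {Cop : 𝒵 →ₗ[𝕜] 𝒴} {hop : 𝒳 →ₗ[𝕜] 𝒴} {Dt : 𝒴 → 𝒳}
    (hc₀ : 0 < c₀) (hC : ∀ B, ‖Cop B‖ ≤ c₀ * ‖B‖) (hC₂ : 0 ≤ C₂)
    (hD : ∀ Y : 𝒴, ‖Y‖ < ε → ‖hop (Dt Y)‖ ≤ 4 * C₂ * ‖Y‖ ^ 2) (hdom : c₀ * ε₁ ≤ ε) {g : 𝕜} {B : 𝒵}
    (hB : ‖g‖ * ‖B‖ < ε₁) :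
    ‖Bprime119 g Cop hop Dt B‖ ≤ (c₀ * (1 + 4 * C₂ * c₀ * ε₁)) * (‖g‖ * ‖B‖) ∧
      (c₀ * (1 + 4 * C₂ * c₀ * ε₁)) * (‖g‖ * ‖B‖) < (c₀ * (1 + 4 * C₂ * c₀ * ε₁)) * ε₁ := by
  have ha0 : 0 ≤ ‖g‖ * ‖B‖ := by positivity
  have hε : c₀ * (‖g‖ * ‖B‖) < ε := lt_of_lt_of_le (mul_lt_mul_of_pos_left hB hc₀) hdom
  have hC₁ : 0 < c₀ * (1 + 4 * C₂ * c₀ * ε₁) := by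
    have : 0 ≤ 4 * C₂ * c₀ * ε₁ := by
      have hε₁ : 0 ≤ ε₁ := ha0.trans hB.le
      positivity
    positivity
  exact ⟨(norm_Bprime119_le hC hC₂ hD hε).trans (B13Sect1Arith.bound_120 hc₀.le hC₂ ha0 hB),
    B13Sect1Arith.lt_120 hC₁ hB⟩

end Eq119

/-! ## (1.1) p. 2 (v3, append-only): the substituted nonlocal argument `𝐀 = (tζ̃_□ + t_□ζ_□)𝐇_k(B′)` -/

section Eq11

variable {𝒴 𝒜 𝒳 : Type*} [NormedAddCommGroup 𝒴] [NormedSpace ℂ 𝒴] [NormedAddCommGroup 𝒜] [NormedSpace ℂ 𝒜]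
  [NormedAddCommGroup 𝒳] [NormedSpace ℂ 𝒳]

/-- **(1.1)** p. 2 [PDF 2], verbatim: *"For example let us consider the last term on the right-hand side of (I.3.34).
We have proved that it is an analytic function of 𝐔, 𝐉, 𝐀, for (𝐔, 𝐉) ∈ U^c_{k+1}(□₀, (1+2β)α₀, (1+2β)α₁, α₀) and 𝐀
satisfying (I.3.31). Substituting* `𝐀 = (tζ̃_□ + t_□ζ_□)𝐇_k(B′)` (1.1) *we introduce, through the function 𝐇_k(B′), a
dependence on 𝐔, 𝐉, B on the whole lattice."* — the operator `tζ̃_□ + t_□ζ_□` of (I.3.34) ([Balaban1987RG1] p. 276: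
interpolation parameters `t`, `t_□` and the cut-off multiplication operators `ζ̃_□`, `ζ_□`, bounded linear) applied to a
vector potential `a` (= 𝐇_k(B′)); typed over the abstract complex normed space `𝒜` of vector potentials of the siblings
`B13Eq117Hk` / `B13Sect1Arith`. [cite: Balaban1988RG2Cluster, (1.1) p.2] -/
def A11 (t tb : ℂ) (ζt ζ : 𝒜 →L[ℂ] 𝒜) (a : 𝒜) : 𝒜 := t • ζt a + tb • ζ a

/-- (1.1) is the application of the single bounded operator `tζ̃_□ + t_□ζ_□`. [cite: Balaban1988RG2Cluster, (1.1) p.2] -/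
theorem A11_eq_apply (t tb : ℂ) (ζt ζ : 𝒜 →L[ℂ] 𝒜) (a : 𝒜) : A11 t tb ζt ζ a = (t • ζt + tb • ζ) a := by
  simp [A11]

/-- The operator bound of (1.1): `‖(tζ̃_□ + t_□ζ_□)a‖ ≤ (|t|‖ζ̃_□‖ + |t_□|‖ζ_□‖)‖a‖`. [cite: Balaban1988RG2Cluster, (1.1) p.2] -/
theorem norm_A11_le (t tb : ℂ) (ζt ζ : 𝒜 →L[ℂ] 𝒜) (a : 𝒜) :
    ‖A11 t tb ζt ζ a‖ ≤ (‖t‖ * ‖ζt‖ + ‖tb‖ * ‖ζ‖) * ‖a‖ := by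
  unfold A11
  calc ‖t • ζt a + tb • ζ a‖ ≤ ‖t • ζt a‖ + ‖tb • ζ a‖ := norm_add_le _ _
    _ ≤ ‖t‖ * (‖ζt‖ * ‖a‖) + ‖tb‖ * (‖ζ‖ * ‖a‖) := by
        rw [norm_smul, norm_smul]
        gcongr
        · exact ζt.le_opNorm a
        · exact ζ.le_opNorm a
    _ = (‖t‖ * ‖ζt‖ + ‖tb‖ * ‖ζ‖) * ‖a‖ := by ring

/-- **(1.1) with the printed argument**: `𝐀 = (tζ̃_□ + t_□ζ_□)𝐇_k(B′)` for the typed `𝐇_k(B′)` of (1.2)/(1.17)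
(`B13Eq117Hk.Hk`, seat p32) — the function of `B′` through which *"a dependence on 𝐔, 𝐉, B on the whole lattice"*
enters. [cite: Balaban1988RG2Cluster, (1.1) p.2] -/
def A11Hk (t tb : ℂ) (ζt ζ : 𝒜 →L[ℂ] 𝒜) (H0 : 𝒴 →ₗ[ℂ] 𝒜) (A0 : 𝒜 → 𝒜) (H : 𝒳 →ₗ[ℂ] 𝒜) (D : 𝒜 → 𝒳)
    (B' : 𝒴) : 𝒜 :=
  A11 t tb ζt ζ (B13Eq117Hk.Hk H0 A0 H D B')

/-- (1.1) ∘ (1.18): on `|B′| < ε₃` the substituted argument obeys `‖𝐀‖ ≤ (|t|‖ζ̃_□‖ + |t_□|‖ζ_□‖)·4B₀e^{16κ₁}|B′|` — the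
operator bound times the bound (1.18) of `B13Eq117Hk.ineq118` (displayed hypotheses exactly as there: `b = B₀e^{16κ₁}`,
(1.14), (1.16), census R2–R4). [cite: Balaban1988RG2Cluster, (1.1) p.2] -/
theorem norm_A11Hk_le {H0 : 𝒴 →ₗ[ℂ] 𝒜} {A0 : 𝒜 → 𝒜} {H : 𝒳 →ₗ[ℂ] 𝒜} {D : 𝒜 → 𝒳} {b C₂ C₄ ε₂ ε₃ : ℝ}
    (hb : 0 < b) (hC₂ : 0 ≤ C₂) (hC₄ : 0 ≤ C₄) (hH0 : ∀ Y, ‖H0 Y‖ ≤ b * ‖Y‖)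
    (hA0 : ∀ Y : 𝒴, ‖Y‖ < ε₃ → ‖A0 (H0 Y)‖ ≤ 4 * C₄ * b ^ 3 * ‖Y‖ ^ 2) (hH : ∀ X, ‖H X‖ ≤ b * ‖X‖)
    (hD : ∀ A' : 𝒜, ‖A'‖ < ε₂ → ‖D A'‖ ≤ 4 * C₂ * ‖A'‖ ^ 2)
    (hR2 : 4 * C₂ * b * ε₂ ≤ 1) (hR3 : 4 * C₄ * b ^ 2 * ε₃ ≤ 1) (hR4 : 2 * b * ε₃ ≤ ε₂)
    (t tb : ℂ) (ζt ζ : 𝒜 →L[ℂ] 𝒜) {B' : 𝒴} (hB : ‖B'‖ < ε₃) :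
    ‖A11Hk t tb ζt ζ H0 A0 H D B'‖ ≤ (‖t‖ * ‖ζt‖ + ‖tb‖ * ‖ζ‖) * (4 * b * ‖B'‖) := by
  have h18 := (B13Eq117Hk.ineq118 hb hC₂ hC₄ hH0 hA0 hH hD hR2 hR3 hR4 hB).1
  exact (norm_A11_le t tb ζt ζ _).trans (mul_le_mul_of_nonneg_left h18 (by positivity))

/-- p. 2: the substituted term is *"an analytic function of 𝐔, 𝐉, B"* — for the typed object, in `B′` on `|B′| < ε₃`:
the bounded operator `tζ̃_□ + t_□ζ_□` composed with the analytic `𝐇_k` of `B13Eq117Hk.analyticOnNhd_Hk` (displayed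
analyticity hypotheses of (1.14)/(1.16) as there). [cite: Balaban1988RG2Cluster, (1.1) p.2] -/
theorem analyticOnNhd_A11Hk {H0 : 𝒴 →ₗ[ℂ] 𝒜} {A0 : 𝒜 → 𝒜} {H : 𝒳 →ₗ[ℂ] 𝒜} {D : 𝒜 → 𝒳} {b C₄ ε₂ ε₃ : ℝ}
    (hb : 0 < b) (hC₄ : 0 ≤ C₄) (hH0 : ∀ Y, ‖H0 Y‖ ≤ b * ‖Y‖)
    (hA0 : ∀ Y : 𝒴, ‖Y‖ < ε₃ → ‖A0 (H0 Y)‖ ≤ 4 * C₄ * b ^ 3 * ‖Y‖ ^ 2) (hH : ∀ X, ‖H X‖ ≤ b * ‖X‖)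
    (hR3 : 4 * C₄ * b ^ 2 * ε₃ ≤ 1) (hR4 : 2 * b * ε₃ ≤ ε₂)
    (hA0a : AnalyticOnNhd ℂ (fun Y : 𝒴 => A0 (H0 Y)) (Metric.ball (0 : 𝒴) ε₃))
    (hDa : AnalyticOnNhd ℂ D (Metric.ball (0 : 𝒜) ε₂)) (t tb : ℂ) (ζt ζ : 𝒜 →L[ℂ] 𝒜) :
    AnalyticOnNhd ℂ (A11Hk t tb ζt ζ H0 A0 H D) (Metric.ball (0 : 𝒴) ε₃) := by
  have hHk := B13Eq117Hk.analyticOnNhd_Hk hb hC₄ hH0 hA0 hH hR3 hR4 hA0a hDa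
  intro Y hY
  have h : AnalyticAt ℂ (fun Y : 𝒴 => (t • ζt + tb • ζ) (B13Eq117Hk.Hk H0 A0 H D Y)) Y :=
    ((t • ζt + tb • ζ).analyticAt _).comp (hHk Y hY)
  have e : A11Hk t tb ζt ζ H0 A0 H D = fun Y : 𝒴 => (t • ζt + tb • ζ) (B13Eq117Hk.Hk H0 A0 H D Y) := by
    funext Y; exact A11_eq_apply t tb ζt ζ _
  rw [e]; exact h

end Eq11

/-! ## (1.6)–(1.7) p. 3 (v3, append-only): the generalized random walk expansion of [13] BY NAME -/

section Eq16

variable {g : B9.Geometry} {bg : B9.Backgrounds}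

/-- **(1.6)** p. 3 [PDF 3], verbatim: *"We start with the original propagators, and we decompose them into generalized
random walk expansions. A propagator is represented by the sum (3.107) [13]* `Σ_ω R₀(X₀)R_{α₁}(X₁)⋯R_{αₙ}(Xₙ),` (1.6)
*where ω = ((0, X₀)(α₁, X₁), …, (αₙ, Xₙ)), X₀, X₁, …, Xₙ are simple localization domains, unions of connected families
containing several cubes from π_k(1), i.e. of the size M₁ instead of M. For more detailed explanations of (1.6) see
Sect. C [13]."* — typed BY NAME of the by-reference source: the propagator (H, G̃ or H₀) at the background `U` IS
represented by a generalized random walk expansion `E` of [Balaban1985BackgroundPropagators] Sect. C as the tree carries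
it (`B9.RWExpansion`: walks ω, |ω|, d(ω, y, y′), walk terms, locality), convergent in the norms of [13]
(`RWExpansion.Converges`; SKELETON row `B9.Thm3.10`, (3.107)). [cite: Balaban1988RG2Cluster, (1.6) p.3] -/
def Eq16 (E : B9.RWExpansion g bg) (U : bg.Cfg) : Prop := E.Converges U

/-- **(1.7)** p. 3 [PDF 3], verbatim: *"Localization properties and bounds are important for us. Each factor in (6.6)
[sic: (1.6)] depends on external gauge field configurations restricted to the corresponding domain X̃ⱼ⁵, and its kernel
vanishes in a sufficiently thick neighborhood of ∂Xⱼ, e.g. in a neighborhood of the width ⅓M₁. The term corresponding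
to a walk ω in (1.6) can be bounded, as (3.108) [13], by* `O(1)O(M₁^{−1/2})^{|ω|}M₁^{−1/2|ω|}exp(−δ₀d(ω, y, y′)),` (1.7)
*where Δ(y), Δ(y′) are localization cubes of the term. This bound holds for all operator norms in formulations of
theorems in [13], e.g. in Theorem 3.1."* — typed over the [13]-carriers: for every walk ω from Δ(y) to Δ(y′) and every
argument J supported in Δ(y′), the ω-term depends on U restricted to X̃⁵₀ ∪ … ∪ X̃⁵ₙ (`LocDep`) and its norm is
≤ `A y · B9.walkFactor C c M₁ (2δ₀) |ω| d(ω,y,y′) · |J|`, where the factor IS the printed one (`walkFactor_17`; B13's δ₀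
= ½ of [13]'s) and `A y` is the prefactor of the norm in question (*"all operator norms … e.g. in Theorem 3.1"*: (Lʲη)²
for the sup-norm (3.42), cf. (3.108)).  `C`, `c` = the two printed O(1). [cite: Balaban1988RG2Cluster, (1.7) p.3] -/
def Ineq17 (E : B9.RWExpansion g bg) (U : bg.Cfg) (A : g.Site → ℝ) (C c M₁ δ₀ : ℝ) : Prop :=
  ∀ (ω : E.Walk) (J : g.Loc) (y y' : g.Site), E.first ω y → E.last ω y' → g.suppIn J y' →
    E.LocDep U ω ∧
      E.term U ω J y ≤ A y * B9.walkFactor C c M₁ (2 * δ₀) (E.wlen ω) (E.wdist ω y y') * g.supNorm J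

/-- (1.6)–(1.7) for the three operators of (1.5), *"H, H₀, G̃"* (p. 3: *"We start with the original propagators, and we
decompose them"*), indexed by `o : O`. [cite: Balaban1988RG2Cluster, (1.6)–(1.7) p.3] -/
def Eq16_17 {O : Type*} (E : O → B9.RWExpansion g bg) (U : bg.Cfg) (A : g.Site → ℝ) (C c M₁ δ₀ : ℝ) : Prop :=
  ∀ o, Eq16 (E o) U ∧ Ineq17 (E o) U A C c M₁ δ₀

/-- The factor of `Ineq17` IS the printed (1.7): `B9.walkFactor C c M₁ (2δ₀) |ω| d = C·(c·M₁^{−1/2})^{|ω|}·M₁^{−|ω|/2}·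
e^{−δ₀d}` ([13] (3.108) prints `e^{−½δ₀d}`; this paper's δ₀ absorbs the ½). [cite: Balaban1988RG2Cluster, (1.7) p.3] -/
theorem walkFactor_17 (C c M₁ δ₀ : ℝ) (n : ℕ) (d : ℝ) :
    B9.walkFactor C c M₁ (2 * δ₀) n d =
      C * (c * M₁ ^ (-(1 / 2 : ℝ))) ^ n * M₁ ^ (-((n : ℝ) / 2)) * Real.exp (-(δ₀ * d)) := by
  unfold B9.walkFactor
  congr 2
  ring

/-- **(1.6)–(1.7) ⇐ [13] Theorem 3.10 as typed** (`B9.Thm310Printed`, SKELETON row `B9.Thm3.10`; p. 3 *"A propagator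
is represented by the sum (3.107) [13] … can be bounded, as (3.108) [13]"*): for every member `i` of the family the
theorem quantifies over, with M ≥ M₂, Mα₀ ≤ a₀ and U regular (3.35), the expansion `E i` satisfies (1.6) and (1.7) with
the sup-norm prefactor `A y = (Lʲη)²`, the constants `C, c` of (3.108), `M₁` = the cube size of the geometry `geo i`
(p. 3: *"of the size M₁ instead of M"*) and B13's `δ₀` = ½·([13]'s δ₀).  Pure bookkeeping; the DEPGRAPH edge
`B13.Eq1.6`/`B13.Eq1.7` → `B9.Thm3.10` as an implication. [cite: Balaban1988RG2Cluster, (1.6)–(1.7) p.3] -/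
theorem eq16_17_of_thm310 {I : Type} {c35 : ℝ} {geo : I → B9.Geometry} {bgs : I → B9.Backgrounds}
    {E : ∀ i, B9.RWExpansion (geo i) (bgs i)} (h : B9.Thm310Printed c35 geo bgs E) :
    ∃ M₂ a₀ δ₀ C c : ℝ, 0 < M₂ ∧ 0 < a₀ ∧ 0 < δ₀ ∧ 0 < C ∧ 0 < c ∧
      ∀ i : I, M₂ ≤ (geo i).M → ∀ α₀ : ℝ, 0 < α₀ → (geo i).M * α₀ ≤ a₀ →
        ∀ U : (bgs i).Cfg, (bgs i).Reg335 c35 α₀ U →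
          Eq16 (E i) U ∧ Ineq17 (E i) U (fun y => ((geo i).len y) ^ 2) C c (geo i).M (δ₀ / 2) := by
  obtain ⟨M₂, a₀, δ₀, C, c, hM, ha, hδ, hC, hc, H⟩ := h
  refine ⟨M₂, a₀, δ₀, C, c, hM, ha, hδ, hC, hc, ?_⟩
  intro i hMi α₀ hα hMa U hU
  obtain ⟨hconv, hterm⟩ := H i hMi α₀ hα hMa U hU
  refine ⟨hconv, ?_⟩
  intro ω J y y' hf hl hJ
  have e : 2 * (δ₀ / 2) = δ₀ := by ring
  rw [e]
  exact hterm ω J y y' hf hl hJ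

/-- p. 3 [PDF 3], verbatim: *"The first two factors in (1.7) are used to control the sum over ω, and they determine the
constant B₀."* — the kernel arithmetic, BY NAME of [13]'s summation engine `B9.walkSum_le`: if there are at most `Nⁿ`
walks of length n from a given cube (`cnt n ≤ Nⁿ`) and `2Nc ≤ M₁^{1/2}`, then every partial sum of (number of walks of
length n) × (the first two factors `O(1)·(O(1)M₁^{−1/2})ⁿ` of (1.7)) is ≤ `2·O(1)` — the constant B₀ (uniform in M₁
past the threshold). [cite: Balaban1988RG2Cluster, (1.7) p.3] -/
theorem sumControl_17 {C N c M₁ : ℝ} (cnt : ℕ → ℝ) (hC : 0 ≤ C) (hN : 0 ≤ N) (hc : 0 ≤ c) (hM : 0 < M₁)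
    (hbig : 2 * N * c ≤ M₁ ^ (1 / 2 : ℝ)) (hcnt0 : ∀ n, 0 ≤ cnt n) (hcnt : ∀ n, cnt n ≤ N ^ n) (m : ℕ) :
    ∑ n ∈ Finset.range m, cnt n * (C * (c * M₁ ^ (-(1 / 2 : ℝ))) ^ n) ≤ 2 * C := by
  have hs : 0 < M₁ ^ (1 / 2 : ℝ) := Real.rpow_pos_of_pos hM _
  have hinv : M₁ ^ (-(1 / 2 : ℝ)) = (M₁ ^ (1 / 2 : ℝ))⁻¹ := Real.rpow_neg hM.le _
  refine B9.walkSum_le_of_count C N c (M₁ ^ (1 / 2 : ℝ)) cnt (fun n => C * (c * M₁ ^ (-(1 / 2 : ℝ))) ^ n)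
    hC hN hc hs hbig hcnt0 hcnt (fun n => le_of_eq ?_) m
  rw [hinv]
  simp only [div_eq_mul_inv]

end Eq16

end Literature.MathematicalPhysics.QuantumFieldTheory.Balaban1983to89.B13Sect1Statements
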